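import Mathlib.GroupTheory.QuotientGroup.Basic
import Mathlib.SetTheory.Cardinal.NatCard
import HarnessLib

/-!
# A nontrivial group on which a locally nilpotent endomorphism is ONTO is infinite
# (helper for crux stmt-BirchSwinnertonDyer-20368 `PrintCf2.SplitBadTwoRankOneOfFacts`; cell `bsd-print-cf2`,
# seat `bsd-line-cf2-p1-w7` g5 — the algebraic half of S3d's class-(iii) bit «Q = S_{W*}(K*_∞)/𝔖_{v̄}(K*_∞, W*) is infinite»)

The registered stub S3d `stub_strictDefectAtVbar_two` of skeleton v12/v13 needs, on the class-(iii) frames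
(`d ≡ 3 (8)` or `d ≡ 14 (16)`), exactly one arithmetic bit: the local-defect quotient
`Q := S_{W*}(K*_∞) ⧸ 𝔖_{v̄}(K*_∞, W*)` is INFINITE (-w3 g11's dichotomy: `Q` embeds `Γ`-equivariantly in
the Prüfer-like `Def ≅ W*`, so `e_δ = 2 ⟺ Q` infinite).  With `ψ_Q` the endomorphism of `Q` induced by
`conj_{γ′} − 1` (locally nilpotent: `Q` is `2`-primary and `γ′` topologically generates), infinitude splits as
**(Q≠0) ∧ (Q_Γ = 0)**, by the pure algebra of this file:

* `not_surjective_of_forall_iterate_eq_zero` — on a FINITE NONTRIVIAL additive group no locally nilpotent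
  endomorphism is surjective (surjective ⟹ bijective ⟹ all iterates injective, but some iterate kills a
  nonzero element);
* **`not_finite_of_surjective_of_forall_iterate_eq_zero`** — hence «`ψ` locally nilpotent, `ψ` onto
  (`Q_ψ = 0`), `Q` nontrivial ⟹ `Q` infinite»;
* `not_finite_quotient_of_forall_exists_sub_mem` — the same for a quotient `A ⧸ N` and an endomorphism
  `φ` of `A` preserving `N`: if every `a` is `φ b − b` modulo `N` for some `b` (coinvariants of the quotient
  vanish), `φ − 1` is locally nilpotent on `A`, and `N ≠ ⊤`, then `A ⧸ N` is infinite.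

HONEST FRAMING: algebra only; the two arithmetic inputs (Q ≠ 0 from level-`K` surjectivity; `Q_Γ = 0` from
the base lift (β)_nr over the line) are NOT proved here.  Closes nothing (`--supports`).  No named fact, no
definition, no `sorry`.  No summit statement is proved by this file; BSD is not proved by any of this.

References: Greenberg–Vatsal 2000 §2 Cor. 2.3 (the surjection `S ↠ ⊕ 𝓗`); Greenberg LNM 1716 §4 p. 124
(«`S_Γ = 0` ⟹ no proper finite-index submodule», the same nilpotence argument dualised).
-/

-- the summit namespace `Summit.BirchSwinnertonDyer.BirchSwinnertonDyer` repeats the problem name by design (D-0017)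
set_option linter.dupNamespace false
set_option autoImplicit false

namespace Summit.BirchSwinnertonDyer.BirchSwinnertonDyer.Theorems.PrintCf2.StrictDefectInfinite

/-- **On a finite nontrivial additive group, a locally nilpotent endomorphism is not surjective**:
a surjective self-map of a finite type is injective, hence so is every iterate; but some iterate kills a
nonzero element. [folklore] -/
theorem not_surjective_of_forall_iterate_eq_zero {Q : Type*} [AddCommGroup Q] [Finite Q] [Nontrivial Q]
    (ψ : Q →+ Q) (hnil : ∀ q : Q, ∃ n : ℕ, ψ^[n] q = 0) : ¬ Function.Surjective ψ := by
  intro hsurj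
  have hinj : Function.Injective ψ := Finite.injective_iff_surjective.mpr hsurj
  obtain ⟨q, hq⟩ := exists_ne (0 : Q)
  obtain ⟨n, hn⟩ := hnil q
  have hinjn : Function.Injective (ψ^[n]) := Function.Injective.iterate hinj n
  have h0 : ψ^[n] 0 = 0 := iterate_map_zero ψ n
  exact hq (hinjn (hn.trans h0.symm))

/-- **`ψ` locally nilpotent and ONTO on a nontrivial group ⟹ the group is infinite** (the class-(iii)
bit of S3d: `Q ≠ 0` and `Q_ψ = 0` force `Q` infinite). [folklore] -/
theorem not_finite_of_surjective_of_forall_iterate_eq_zero {Q : Type*} [AddCommGroup Q] [Nontrivial Q]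
    (ψ : Q →+ Q) (hnil : ∀ q : Q, ∃ n : ℕ, ψ^[n] q = 0) (hsurj : Function.Surjective ψ) :
    ¬ Finite Q := by
  intro hfin
  exact not_surjective_of_forall_iterate_eq_zero ψ hnil hsurj

/-- **Quotient form.** `N ≤ A` a subgroup stable under an endomorphism `φ` of `A` with `φ − 1` locally
nilpotent on `A`; if `N ≠ ⊤` (the quotient is nontrivial) and every class is a `φ`-coboundary modulo `N`
(`∀ a, ∃ b, φ b − b − a ∈ N`: the coinvariants of `A ⧸ N` vanish), then `A ⧸ N` is infinite.  Shape used
by S3d: `A = S_{W*}(K*_∞)` (unramified Selmer group over the line), `N = 𝔖_{v̄}(K*_∞, W*)`, `φ = conj_{γ′}`.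
[folklore] -/
theorem not_finite_quotient_of_forall_exists_sub_mem {A : Type*} [AddCommGroup A] (N : AddSubgroup A)
    (φ : A →+ A) (hN : ∀ a ∈ N, φ a ∈ N) (hnil : ∀ a : A, ∃ n : ℕ, (φ - AddMonoidHom.id A)^[n] a = 0)
    (hne : N ≠ ⊤) (hcob : ∀ a : A, ∃ b : A, φ b - b - a ∈ N) : ¬ Finite (A ⧸ N) := by
  -- the induced endomorphism `ψ` of `A ⧸ N`
  let ψ : A ⧸ N →+ A ⧸ N :=
    QuotientAddGroup.map N N (φ - AddMonoidHom.id A) fun a ha ↦ by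
      rw [AddSubgroup.mem_comap, AddMonoidHom.sub_apply, AddMonoidHom.id_apply]
      exact N.sub_mem (hN a ha) ha
  have hψ : ∀ a : A, ψ (QuotientAddGroup.mk a) = QuotientAddGroup.mk ((φ - AddMonoidHom.id A) a) :=
    fun _ ↦ rfl
  have hψn : ∀ (n : ℕ) (a : A), ψ^[n] (QuotientAddGroup.mk a) =
      QuotientAddGroup.mk ((φ - AddMonoidHom.id A)^[n] a) := by
    intro n
    induction n with
    | zero => intro a; rfl
    | succ n ih =>
      intro a
      rw [Function.iterate_succ_apply, Function.iterate_succ_apply, hψ, ih]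
  haveI : Nontrivial (A ⧸ N) := by
    rw [QuotientAddGroup.nontrivial_iff]
    exact hne
  refine not_finite_of_surjective_of_forall_iterate_eq_zero ψ (fun q ↦ ?_) (fun q ↦ ?_)
  · obtain ⟨a, rfl⟩ := QuotientAddGroup.mk_surjective q
    obtain ⟨n, hn⟩ := hnil a
    exact ⟨n, by rw [hψn, hn, QuotientAddGroup.mk_zero]⟩
  · obtain ⟨a, rfl⟩ := QuotientAddGroup.mk_surjective q
    obtain ⟨b, hb⟩ := hcob a
    refine ⟨QuotientAddGroup.mk b, ?_⟩
    rw [hψ, QuotientAddGroup.eq_iff_sub_mem]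
    simpa only [AddMonoidHom.sub_apply, AddMonoidHom.id_apply] using hb

end Summit.BirchSwinnertonDyer.BirchSwinnertonDyer.Theorems.PrintCf2.StrictDefectInfinite
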